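import Literature.Barriers.CriticalPhenomena.GaussianDominationRouteLaceExpansionPivotal
import HarnessLib

/-!
# [FitznerVanDerHofstad2017, Def. 3.4, (3.12)–(3.13)] against the tree's `IsPivotalBond` / `laceE`:
# a pivotal bond is automatically occupied on `{x ↔ y}`; (3.13) read with "occupied and pivotal"
# is the tree's `laceE`; the prose sentence of Def. 3.4 is direction-blind (hence looser than (3.12))

PRINT ([FitznerVanDerHofstad2017, Def. 3.4], arXiv:1506.07977v2 p. 23 = EJP 22:43 p. 21): "A directed
bond `(u,v)` is pivotal for the connection from `x` to `y`, if `x ↔ u`, `v ↔ y` and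
`y ∉ C̃^{{u,v}}(x)`." — then (3.12): "In terms of Definition 3.1, we have the characterization of a
pivotal bond for `v → y` as `{b pivotal for v → y} = ({v ↔ b̲, b̄ ∉ C̃^b(v)} in B(C̃^b(v)) ∖ {b}) ∩
(b̄ ↔ y in B(C̃^b(v))^c)`" and (3.13): "`E′(v,y;A) = {v ↔^A y} ∩ (∄ b′ occupied and pivotal for
v → y such that v ↔^A b̲′)`".

LEAN. The tree (`GaussianDominationRouteLaceExpansion`) types directed pivotality configuration-
intrinsically, `IsPivotalBond ω x y u v := {u,v} a bond ∧ u ∈ C̃^{(u,v)}(x) ∧ v ↔ y in ℤ^d ∖ C̃^{(u,v)}(x)`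
([Slade2006LaceExpansion, (9.76)]; this is (3.12) with "in the bond set `B(C̃)^c`" = "through vertices
of `C̃^c` only"), and `laceE A v y` = (3.13) WITHOUT the word "occupied". This file records, in the
kernel, exactly how the printed words relate to that typing:

* `laceEOcc_eq_laceE` — the literal (3.13), with the word "occupied", equals `laceE`: on `{v ↔ y}` a
  pivotal bond is occupied (the tree's `mem_of_isPivotalBond`, `GaussianDominationRouteLaceExpansionPivotal`,
  [HeydenreichVanDerHofstad2017, Def. 6.3(c)]);
* `isPivotalWording_of_isPivotalBond` — `IsPivotalBond` implies the three clauses of the prose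
  sentence of Def. 3.4 (`x ↔ u`, `v ↔ y`, `y ∉ C̃^{{u,v}}(x)`);
* `isPivotalWording_swap` / `not_isPivotalBond_swap` / `isPivotalWording_and_not_isPivotalBond` —
  the prose sentence, read literally with the unrestricted connections `↔` of Def. 3.1(i), holds for
  `(v,u)` whenever it holds for `(u,v)` on `{x ↔ y}`, whereas `IsPivotalBond` never holds for both
  orientations: so the prose sentence is strictly looser than (3.12) as soon as a pivotal bond exists,
  and (3.12) (= the tree's typing) is the operative definition. This is a remark on wording only; no
  formula of [FitznerVanDerHofstad2017] §3 depends on the prose reading.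

## References

* R. Fitzner, R. van der Hofstad, EJP 22 (2017) no. 43, Def. 3.1, Def. 3.4, (3.12)–(3.13)
  (arXiv v2 pp. 21–23).
* G. Slade, LNM 1879 (2006), (9.76). M. Heydenreich, R. van der Hofstad (2017), Def. 6.3(c), (6.2.11).
-/

namespace Literature.Barriers.CriticalPhenomena

open Literature.Probability.LatticeModels Literature.Probability.Percolation

variable {d : ℕ}

/-- Monotonicity of `{x ↔ y}` in the configuration. [folklore] -/
theorem openConn_mono_config {ω ω' : BondConfig (Site d)} (h : ω ⊆ ω') {x y : Site d}
    (hxy : ω ∈ openConn x y) : ω' ∈ openConn x y :=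
  SimpleGraph.Reachable.mono (openGraph_mono h) hxy

/-- `{x ↔ y in S} ⊆ {x ↔ y}`. [folklore] -/
theorem openConn_of_openConnIn {S : Set (Site d)} {x y : Site d} {ω : BondConfig (Site d)}
    (h : ω ∈ openConnIn S x y) : ω ∈ openConn x y := by
  obtain ⟨hx, hy, hr⟩ := h
  have h' : (openGraph ω).Reachable x y := by simpa using hr.map (SimpleGraph.Embedding.induce S).toHom
  exact h'

/-- `C̃^{(v,u)}(x) = C̃^{(u,v)}(x)` (the removed bond is undirected). [cite: FitznerVanDerHofstad2017, Def. 3.1(vi)] -/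
theorem restrCluster_swap (u v x : Site d) (ω : BondConfig (Site d)) :
    restrCluster v u x ω = restrCluster u v x ω := by
  rw [restrCluster, restrCluster, Sym2.eq_swap]

/-- Def. 3.4 (i), first clause: `x ↔ u`. [cite: FitznerVanDerHofstad2017, Def. 3.4 (arXiv v2 p. 23)] -/
theorem openConn_fst_of_isPivotalBond {ω : BondConfig (Site d)} {x y u v : Site d}
    (h : IsPivotalBond ω x y u v) : ω ∈ openConn x u :=
  openConn_mono_config Set.sdiff_subset h.2.1

/-- Def. 3.4 (i), second clause: `v ↔ y`. [cite: FitznerVanDerHofstad2017, Def. 3.4 (arXiv v2 p. 23)] -/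
theorem openConn_snd_of_isPivotalBond {ω : BondConfig (Site d)} {x y u v : Site d}
    (h : IsPivotalBond ω x y u v) : ω ∈ openConn v y :=
  openConn_of_openConnIn h.2.2

/-- **(3.13) read literally**: `E′(v,y;A) = {v ↔^A y} ∩ (∄ (u′,v′) OCCUPIED and pivotal for v → y with
v ↔^A u′)`. [cite: FitznerVanDerHofstad2017, (3.13) (arXiv v2 p. 23)] -/
def laceEOcc (A : Set (Site d)) (v y : Site d) : Set (BondConfig (Site d)) :=
  {ω | ω ∈ connThrough A v y ∧
    ∀ u' v' : Site d, s(u', v') ∈ ω → IsPivotalBond ω v y u' v' → ω ∉ connThrough A v u'}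

/-- **The literal (3.13) is the tree's `laceE`** (the word "occupied" is automatic on `{v ↔^A y}`).
[cite: FitznerVanDerHofstad2017, (3.13) (arXiv v2 p. 23)] [cite: HeydenreichVanDerHofstad2017, (6.2.11)] -/
theorem laceEOcc_eq_laceE (A : Set (Site d)) (v y : Site d) : laceEOcc A v y = laceE A v y := by
  ext ω
  exact ⟨fun h => ⟨h.1, fun u' v' hp =>
      h.2 u' v' (mem_of_isPivotalBond (connThrough_subset_openConn A v y h.1) hp) hp⟩,
    fun h => ⟨h.1, fun u' v' _ hp => h.2 u' v' hp⟩⟩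

/-- **The prose sentence of Def. 3.4, literally**: "`(u,v)` is pivotal for the connection from `x` to `y`
if `x ↔ u`, `v ↔ y` and `y ∉ C̃^{{u,v}}(x)`" (with `{u,v}` a bond and `↔` the unrestricted connection
of Def. 3.1(i)). [cite: FitznerVanDerHofstad2017, Def. 3.4 (arXiv v2 p. 23)] -/
def IsPivotalWording (ω : BondConfig (Site d)) (x y u v : Site d) : Prop :=
  (zdGraph d).Adj u v ∧ ω ∈ openConn x u ∧ ω ∈ openConn v y ∧ y ∉ restrCluster u v x ω

/-- `IsPivotalBond` (= (3.12)) implies the prose sentence of Def. 3.4. [cite: FitznerVanDerHofstad2017, Def. 3.4, (3.12)] -/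
theorem isPivotalWording_of_isPivotalBond {ω : BondConfig (Site d)} {x y u v : Site d}
    (h : IsPivotalBond ω x y u v) : IsPivotalWording ω x y u v :=
  ⟨h.1, openConn_fst_of_isPivotalBond h, openConn_snd_of_isPivotalBond h, h.notMem_target⟩

/-- **The prose sentence is direction-blind on `{x ↔ y}`**: if it holds for `(u,v)` it holds for `(v,u)`.
[cite: FitznerVanDerHofstad2017, Def. 3.4 (arXiv v2 p. 23)] -/
theorem isPivotalWording_swap {ω : BondConfig (Site d)} {x y u v : Site d}
    (h : IsPivotalWording ω x y u v) (hxy : ω ∈ openConn x y) : IsPivotalWording ω x y v u := by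
  obtain ⟨hadj, hxu, hvy, hy⟩ := h
  refine ⟨hadj.symm, ?_, ?_, ?_⟩
  · exact SimpleGraph.Reachable.trans hxy (SimpleGraph.Reachable.symm hvy)
  · exact SimpleGraph.Reachable.trans (SimpleGraph.Reachable.symm hxu) hxy
  · rwa [restrCluster_swap]

/-- **(3.12) is oriented**: `(u,v)` and `(v,u)` are never both pivotal for `x → y`.
[cite: FitznerVanDerHofstad2017, (3.12) (arXiv v2 p. 23)] [cite: Slade2006LaceExpansion, (9.76)] -/
theorem not_isPivotalBond_swap {ω : BondConfig (Site d)} {x y u v : Site d}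
    (h : IsPivotalBond ω x y u v) : ¬ IsPivotalBond ω x y v u := fun h' =>
  h.notMem_fst (by rw [← restrCluster_swap]; exact h'.2.1)

/-- **What does not transfer, exactly**: on `{x ↔ y}`, whenever `(u,v)` is pivotal in the sense of (3.12)
(= `IsPivotalBond`), the reversed bond `(v,u)` satisfies the prose sentence of Def. 3.4 but is NOT
pivotal in the sense of (3.12); so the prose sentence is strictly weaker than (3.12) and cannot serve as
the definition (the paper's own (3.12)–(3.13) are the operative ones, and they are the tree's typing).
[cite: FitznerVanDerHofstad2017, Def. 3.4, (3.12) (arXiv v2 p. 23)] -/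
theorem isPivotalWording_and_not_isPivotalBond {ω : BondConfig (Site d)} {x y u v : Site d}
    (h : IsPivotalBond ω x y u v) (hxy : ω ∈ openConn x y) :
    IsPivotalWording ω x y v u ∧ ¬ IsPivotalBond ω x y v u :=
  ⟨isPivotalWording_swap (isPivotalWording_of_isPivotalBond h) hxy, not_isPivotalBond_swap h⟩

end Literature.Barriers.CriticalPhenomena
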